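import Literature.NumberTheory.PAdicHodge.FontainePstInductionSchemataProofs
import HarnessLib

/-!
# De Rham-ness of `Ind_{Γ_E}^{Γ_K} W` is EQUIVALENT to de Rham-ness of `W`, over any number field `K`
# (Patrikis 2019, Lemma 7.2.1, "`V` is de Rham if and only if `W` is"; Fontaine, Exposé III, Prop. 1.5.2)

Topic `NumberTheory/PAdicHodge`.  PROOF FILE (theorems only: no definition, no named fact, no
instance; D-0026).  The tree has the upward half of Patrikis's Lemma 7.2.1 for THE pinned Fontaine
data over an arbitrary base (`IsDeRhamFramedInduceSchema_holds`, file
`FontainePstInductionSchemataProofs`: `W` de Rham at all `w ∣ ℓ` ⇒ `Ind_{Γ_E}^{Γ_K} W` de Rham at all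
`v ∣ ℓ`) and the downward half ONLY OVER `K = ℚ` (the named fact
`isDeRhamFramed_of_isDeRhamFramed_induce`, discharged in `DeRhamInducedRepresentationProofs` by
Mackey's formula at the trivial coset; `DeRhamInduceLocal` records the local downward half as "not
here").  This file proves the downward half over an ARBITRARY number field `K` and hence the
equivalence — the "TODO(general form): the equivalence (`V` de Rham iff `W` de Rham)" of the docstring
of `IsDeRhamFramedInduceSchema`:

* `Literature.NumberTheory.PAdicHodge.isDeRhamFramed_toLocal_of_induce` — for number fields `K ⊆ E`
  with `[E : K] = d`, a prime `ℓ` and a framed `W : Γ_E → GL_n(ℚ̄_ℓ)`: if `Ind_{Γ_E}^{Γ_K} W`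
  (`FramedGaloisRep.induce`) is de Rham at every place `v ∣ ℓ` of `K` for THE pinned data
  `fontainePstAdicCompletion v ℓ hv`, then `W` is de Rham at every place `w ∣ ℓ` of `E`;
* `Literature.NumberTheory.PAdicHodge.isDeRhamFramed_induce_iff` — the equivalence.

On the way (§1–§2), Fontaine's Prop. 1.5.2 for direct SUMMANDS in the tree's framed block-diagonal
format (the converses of the accepted `isAdmissible_restrictScalars_of_blockDiagonal`,
`FramedRep.IsDeRhamWith.of_blockDiagonal`, `PstWeilDeligneData.isDeRhamFramed_of_blockDiagonal`, which
go from the blocks to the sum): `PeriodRingData.isAdmissible_restrictScalars_blockDiagonal_iff`,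
`FramedRep.IsDeRhamWith.block_of_blockDiagonal`, `PstWeilDeligneData.isDeRhamFramed_block_of_blockDiagonal`.

## The argument (Galois closure instead of Mackey's formula, as in `FontainePstInductionSchemataProofs`)

The printed proof ("comparing dimensions"; globalised by Mackey's decomposition
`(Ind_E^K W)|_{Γ_{K_v}} ≅ ⊕_{w ∣ v} Ind_{E_w}^{K_v} W|_{Γ_{E_w}}` and stability of de Rham
representations under direct summands, Brinon–Conrad Thm. 5.2.1) computes `D_dR` of an induced
representation.  The tree has no functorial `D_dR`; as in the accepted proof of the upward half we
use instead the two halves of Brinon–Conrad's Prop. 6.3.8 for the pinned data — upwards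
`isDeRhamFramed_toLocal_restrictField` (from `DeRhamBaseChange_holds`) and downwards
`DeRhamRestrictFieldDescent_holds` — and Fontaine's Prop. 1.5.2 (a direct summand of a `B`-admissible
representation is admissible, `PeriodRingData.isAdmissible_pi_iff`), and elementary Galois theory:

1. (§1–§2, Fontaine Prop. 1.5.2 for framed block-diagonal representations.)  If
   `T : Γ_F → GL_{N}(ℚ̄_ℓ)` is block diagonal, `T(g) = e·diag(B₁(g), …, B_d(g))·e⁻¹` along
   `e : Fin d × Fin n ≃ Fin N`, and `T` is de Rham for `(alg, 𝔅)`, then every block `Bᵢ` is de Rham: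
   descend the frame of a finite model of `T` (`exists_conj_baseChange_eq_of_hasQlModel`:
   `T = T_{E'} ⊗_{E'} ℚ̄_ℓ` on the nose, `T_{E'}` admissible by `isAdmissible_restrictScalars_conj_iff`,
   `…_baseChange_iff`), corestrict the blocks to `E'` (`FramedRep.exists_baseChange_eq`; their entries
   are entries of `T`), observe that `T_{E'}` is block diagonal with these blocks, and split the
   admissibility along the `ℚ_ℓ[Γ]`-isomorphism `⊕ᵢ E'ⁿ ≅ E'^N`
   (`isAdmissible_restrictScalars_blockDiagonal_iff`, same proof as the accepted one-way lemma).
2. (§3, the blocks of `(Ind_E^K W)|_{Γ_L}` for the Galois closure `L` of `E/K` in `K̄`.)  For the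
   transversal `rᵢ` of `Γ_K / res(Γ_E)` used by `induce` (`absGaloisCosetRep`) one has
   `rᵢ ε(E) ⊆ λ(L)` (`ε`, `λ` the embeddings `absEmbedding`), so `(Ind W)(res σ)`, `σ ∈ Γ_L`, is block
   diagonal ON THE NOSE (`induce_apply_coe_of_forall_conj_mem`), and the `i`-th block is the change of
   frame `W(tᵢ) (W|_{Γ_L, εᵢ}) W(tᵢ)⁻¹` of the restriction of `W` to `Γ_L` along the embedding
   `εᵢ = λ⁻¹ ∘ rᵢ ∘ ε : E → L` (`exists_ringHom_conj_absGaloisRestrict_eq`, from the accepted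
   `exists_conj_absGaloisRestrict_eq_of_absEmbedding_eq`: restriction maps are well defined up to
   conjugacy).
3. (§4.)  If `Ind W` is de Rham at the places of `K` above `ℓ`, then `(Ind W)|_{Γ_L}` is de Rham at
   every `u ∣ ℓ` of `L` (upward half), hence so is its block `W(t₀) (W|_{Γ_L, ε₀}) W(t₀)⁻¹` (step 1)
   and, the frame being irrelevant (`isDeRhamFramed_conj_iff`), `W|_{Γ_L}` for the `E`-algebra
   structure `ε₀` on `L`; by the downward half along `ε₀ : E → L`, `W` is de Rham at every `w ∣ ℓ`
   of `E`.

## References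

* [Patrikis2019] S. Patrikis, *Variations on a theorem of Tate*, Mem. Amer. Math. Soc. 258 (2019),
  no. 1238, §7.2 Lemma 7.2.1 (arXiv:1207.6724 p. 38).
* [BrinonConrad2009] O. Brinon, B. Conrad, *CMI Summer School notes on p-adic Hodge theory* (2009),
  Thm. 5.2.1 (exactness and sums), Prop. 6.3.8 (finite base change).
* [FontaineAsterisque223III] J.-M. Fontaine, *Représentations p-adiques semi-stables*, Astérisque 223
  (1994), Exposé III, Prop. 1.5.2 (sub-objects and sums of `B`-admissible representations).
* [MilneFT2022] J. S. Milne, *Fields and Galois Theory* (v4.60), Ch. 7 (the absolute Galois group is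
  defined up to an inner automorphism).
-/

noncomputable section

open scoped NumberField MatrixGroups Matrix TensorProduct
open NumberField IsDedekindDomain Field
open Literature.NumberTheory.Automorphic Literature.NumberTheory.PAdicHodge

namespace Literature.NumberTheory.GaloisRepresentations

/-! ### §1 Block-diagonal framed representations over `E'`: admissible iff all blocks are
(Fontaine, Exposé III, Prop. 1.5.2: sums and summands) -/

namespace PeriodRingData

section BlockDiagonal

-- Mathlib's own global value (nested instance problems on `𝔅.B ⊗[P] M`, see `PAdicHodgeProofs`).
set_option maxSynthPendingDepth 3

universe u v' w

variable {p : ℕ} [Fact p.Prime] {Γ : Type u} [Group Γ] [TopologicalSpace Γ]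
  {E₁ : Type v'} [Field E₁] [Algebra ℚ_[p] E₁] (𝔅 : PeriodRingData.{u, 0, v', w} Γ ℚ_[p] E₁)

/-- **Block-diagonal representations are admissible iff all their blocks are** (framed form of
Fontaine's Prop. 1.5.2 for direct sums AND direct summands; the accepted
`isAdmissible_restrictScalars_of_blockDiagonal` is the `if` half, with the same proof).  If
`T : Γ →ₜ* GL_N(E')` (`E'/ℚ_p` finite) is block diagonal along `e : Fin d × Fin n ≃ Fin N`,
`T(g) = e·diag(S₁(g), …, S_d(g))·e⁻¹` with framed `Sᵢ : Γ →ₜ* GL_n(E')`, then the `ℚ_p`-restriction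
of `T` is `B`-admissible iff that of every `Sᵢ` is: `w ↦ (j ↦ w (e⁻¹ j))` is an isomorphism of
`ℚ_p[Γ]`-modules `⊕ᵢ E'ⁿ ≅ E'^N`, and finite direct sums are admissible iff all summands are
(`isAdmissible_pi_iff`). [cite: FontaineAsterisque223III, Prop. 1.5.2] -/
theorem isAdmissible_restrictScalars_blockDiagonal_iff
    {E' : IntermediateField ℚ_[p] (PadicAlgCl p)} [FiniteDimensional ℚ_[p] E'] {d n N : ℕ}
    (e : Fin d × Fin n ≃ Fin N) (T : FramedRep Γ E' N) (S : Fin d → FramedRep Γ E' n)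
    (hT : ∀ g, ((T g : GL (Fin N) E') : Matrix (Fin N) (Fin N) E') =
      Matrix.reindex e e (Matrix.comp (Fin d) (Fin d) (Fin n) (Fin n) E'
        (Matrix.diagonal fun i => ((S i g : GL (Fin n) E') : Matrix (Fin n) (Fin n) E')))) :
    𝔅.IsAdmissible (FramedRep.restrictScalars ℚ_[p] T) ↔
      ∀ i, 𝔅.IsAdmissible (FramedRep.restrictScalars ℚ_[p] (S i)) := by
  classical
  obtain ⟨ρπ, hρπ⟩ :=
    ContinuousRep.exists_pi (fun i : Fin d => FramedRep.restrictScalars ℚ_[p] (S i))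
  -- the `ℚ_p`-linear isomorphism `⊕ᵢ E'ⁿ ≃ E'^N`, `w ↦ (j ↦ w (e⁻¹ j).1 (e⁻¹ j).2)`
  let Φ : (Fin d → Fin n → E') ≃ₗ[ℚ_[p]] (Fin N → E') :=
    { toFun := fun w j => w (e.symm j).1 (e.symm j).2
      invFun := fun v i k => v (e (i, k))
      map_add' := fun _ _ => rfl
      map_smul' := fun _ _ => rfl
      left_inv := fun w => by
        funext i k
        simp only [Equiv.symm_apply_apply]
      right_inv := fun v => by
        funext j
        simp only [Prod.mk.eta, Equiv.apply_symm_apply] }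
  have hΦ : ∀ (σ : Γ) (w : Fin d → Fin n → E'),
      Φ (ρπ σ w) = FramedRep.restrictScalars ℚ_[p] T σ (Φ w) := by
    intro σ w
    funext j
    change ρπ σ w (e.symm j).1 (e.symm j).2 = _
    rw [hρπ, FramedRep.restrictScalars_apply_apply, FramedRep.restrictScalars_apply_apply, hT,
      Matrix.mulVec, Matrix.mulVec, dotProduct, dotProduct, ← e.sum_comp]
    change _ = ∑ x : Fin d × Fin n, (Matrix.reindex e e _) j (e x) * w (e.symm (e x)).1 (e.symm (e x)).2
    have hsplit : ∀ x : Fin d × Fin n, (Matrix.reindex e e (Matrix.comp (Fin d) (Fin d) (Fin n) (Fin n) E'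
        (Matrix.diagonal fun i => ((S i σ : GL (Fin n) E') : Matrix (Fin n) (Fin n) E')))) j (e x) =
        if (e.symm j).1 = x.1 then ((S (e.symm j).1 σ : GL (Fin n) E') : Matrix (Fin n) (Fin n) E')
          (e.symm j).2 x.2 else 0 := fun x => by
      rw [Matrix.reindex_apply, Matrix.submatrix_apply, Equiv.symm_apply_apply, Matrix.comp_apply,
        Matrix.diagonal_apply]
      split_ifs with h
      · rfl
      · rfl
    simp only [hsplit, Fintype.sum_prod_type, Equiv.symm_apply_apply]
    rw [Finset.sum_eq_single (e.symm j).1]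
    · simp
    · intro i _ hi
      simp only [if_neg (Ne.symm hi), zero_mul, Finset.sum_const_zero]
    · intro h
      exact absurd (Finset.mem_univ _) h
  rw [← 𝔅.isAdmissible_iff_of_equiv ρπ _ Φ hΦ,
    𝔅.isAdmissible_pi_iff ρπ (fun i : Fin d => FramedRep.restrictScalars ℚ_[p] (S i)) hρπ]

end BlockDiagonal

end PeriodRingData

/-! ### §2 A block of a de Rham block-diagonal framed representation is de Rham -/

section DeRhamBlockDiagonal

variable {F : Type} [Field F] {ℓ : ℕ} [Fact ℓ.Prime]

-- Mathlib's own global value (nested instance problems on `𝔅.B ⊗[P] M`, see `PAdicHodgeProofs`).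
set_option maxSynthPendingDepth 3 in
/-- **A block of a de Rham block-diagonal framed representation is de Rham** (Fontaine, Exposé
III, Prop. 1.5.2: direct summands of `B`-admissible representations are `B`-admissible; converse of
the accepted `FramedRep.IsDeRhamWith.of_blockDiagonal`).  For a `ℚ_ℓ`-algebra structure `alg` on `F`
and a period-ring datum `𝔅` for `Γ_F`: if `T : Γ_F →ₜ* GL_N(ℚ̄_ℓ)` is block diagonal along
`e : Fin d × Fin n ≃ Fin N`, `T(g) = e·diag(B₁(g), …, B_d(g))·e⁻¹` with framed
`Bᵢ : Γ_F →ₜ* GL_n(ℚ̄_ℓ)`, and `T` is de Rham for `(alg, 𝔅)` (accepted `FramedRep.IsDeRhamWith`), then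
every `Bᵢ` is de Rham for `(alg, 𝔅)`: descend the frame of a finite model of `T`
(`exists_conj_baseChange_eq_of_hasQlModel`, admissibility kept by `isAdmissible_restrictScalars_conj_iff`,
`isAdmissible_restrictScalars_baseChange_iff`), corestrict the blocks to the same finite `E'`
(`FramedRep.exists_baseChange_eq`) and split (`isAdmissible_restrictScalars_blockDiagonal_iff`).
[cite: FontaineAsterisque223III, Prop. 1.5.2] [cite: BrinonConrad2009, Thm. 5.2.1] -/
theorem FramedRep.IsDeRhamWith.block_of_blockDiagonal (alg : Algebra ℚ_[ℓ] F)
    (𝔅 : PeriodRingData.{0, 0, 0, 0} (absoluteGaloisGroup F) ℚ_[ℓ] F) {d n N : ℕ}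
    (e : Fin d × Fin n ≃ Fin N) {T : FramedRep (absoluteGaloisGroup F) (PadicAlgCl ℓ) N}
    {B : Fin d → FramedRep (absoluteGaloisGroup F) (PadicAlgCl ℓ) n}
    (hT : ∀ g, ((T g : GL (Fin N) (PadicAlgCl ℓ)) : Matrix (Fin N) (Fin N) (PadicAlgCl ℓ)) =
      Matrix.reindex e e (Matrix.comp (Fin d) (Fin d) (Fin n) (Fin n) (PadicAlgCl ℓ)
        (Matrix.diagonal fun i =>
          ((B i g : GL (Fin n) (PadicAlgCl ℓ)) : Matrix (Fin n) (Fin n) (PadicAlgCl ℓ)))))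
    (h : T.IsDeRhamWith alg 𝔅) (i₀ : Fin d) : (B i₀).IsDeRhamWith alg 𝔅 := by
  letI := alg
  classical
  obtain ⟨E, hE, rE, hmodel, hadm⟩ := h
  haveI := hE
  obtain ⟨E', hEE', hE', Q, hTQ⟩ := exists_conj_baseChange_eq_of_hasQlModel hmodel
  haveI := hE'
  -- the descended model `TE` of `T` over `E'`: `T = TE ⊗_{E'} ℚ̄_ℓ` on the nose
  set TE : FramedRep (absoluteGaloisGroup F) E' N := FramedRep.conj Q
    (rE.baseChange (IntermediateField.inclusion hEE').toRingHom
      (continuous_intermediateField_inclusion hEE')) with hTEdef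
  have hadmTE : 𝔅.IsAdmissible (FramedRep.restrictScalars ℚ_[ℓ] TE) := by
    rw [hTEdef, 𝔅.isAdmissible_restrictScalars_conj_iff, 𝔅.isAdmissible_restrictScalars_baseChange_iff]
    exact hadm
  -- entries of `T`, hence of the blocks, lie in `E'`
  have hTmem : ∀ g a b, ((T g : GL (Fin N) (PadicAlgCl ℓ)) :
      Matrix (Fin N) (Fin N) (PadicAlgCl ℓ)) a b ∈ E' := fun g a b => by
    rw [← hTQ]
    exact TE.baseChange_apply_mem g a b
  have hBT : ∀ i g k l, ((B i g : GL (Fin n) (PadicAlgCl ℓ)) : Matrix (Fin n) (Fin n) (PadicAlgCl ℓ)) k l =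
      ((T g : GL (Fin N) (PadicAlgCl ℓ)) : Matrix (Fin N) (Fin N) (PadicAlgCl ℓ)) (e (i, k)) (e (i, l)) :=
    fun i g k l => by
    rw [hT g, Matrix.reindex_apply, Matrix.submatrix_apply, Equiv.symm_apply_apply,
      Equiv.symm_apply_apply, Matrix.comp_apply, Matrix.diagonal_apply, if_pos rfl]
  have hBmem : ∀ i g k l, ((B i g : GL (Fin n) (PadicAlgCl ℓ)) :
      Matrix (Fin n) (Fin n) (PadicAlgCl ℓ)) k l ∈ E' ∧ (((B i g)⁻¹ : GL (Fin n) (PadicAlgCl ℓ)) :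
        Matrix (Fin n) (Fin n) (PadicAlgCl ℓ)) k l ∈ E' := fun i g k l =>
    ⟨by rw [hBT]; exact hTmem g _ _, by rw [← map_inv, hBT]; exact hTmem g⁻¹ _ _⟩
  choose BE hBE using fun i => FramedRep.exists_baseChange_eq (B i) E' (hBmem i)
  -- `TE` is block diagonal over `E'` with blocks `BEᵢ`
  have hTE : ∀ g, ((TE g : GL (Fin N) E') : Matrix (Fin N) (Fin N) E') =
      Matrix.reindex e e (Matrix.comp (Fin d) (Fin d) (Fin n) (Fin n) E'
        (Matrix.diagonal fun i => ((BE i g : GL (Fin n) E') : Matrix (Fin n) (Fin n) E'))) := by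
    intro g
    apply Matrix.map_injective (algebraMap E' (PadicAlgCl ℓ)).injective
    change ((TE g : GL (Fin N) E') : Matrix (Fin N) (Fin N) E').map (algebraMap E' (PadicAlgCl ℓ)) =
      (Matrix.reindex e e (Matrix.comp (Fin d) (Fin d) (Fin n) (Fin n) E'
        (Matrix.diagonal fun i => ((BE i g : GL (Fin n) E') : Matrix (Fin n) (Fin n) E')))).map
          (algebraMap E' (PadicAlgCl ℓ))
    rw [← FramedRep.coe_baseChange_apply (algebraMap E' (PadicAlgCl ℓ)) continuous_subtype_val TE g,
      hTQ, hT g]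
    ext a b
    simp only [Matrix.map_apply, Matrix.reindex_apply, Matrix.submatrix_apply, Matrix.comp_apply,
      Matrix.diagonal_apply]
    split_ifs with h
    · rw [← hBE, FramedRep.coe_baseChange_apply, Matrix.map_apply]
    · rw [Matrix.zero_apply, Matrix.zero_apply, map_zero]
  -- split the admissibility of `TE`
  have hadmB : 𝔅.IsAdmissible (FramedRep.restrictScalars ℚ_[ℓ] (BE i₀)) :=
    (𝔅.isAdmissible_restrictScalars_blockDiagonal_iff e TE BE hTE).1 hadmTE i₀
  exact ⟨E', hE', BE i₀, ⟨1, by rw [hBE, FramedRep.conj_one_eq]⟩, hadmB⟩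

/-- **A block of a de Rham block-diagonal framed representation is de Rham, for a `p`-adic Hodge
datum** (accepted `PstWeilDeligneData.IsDeRhamFramed`; `FramedRep.IsDeRhamWith.block_of_blockDiagonal`
for `(𝔇.algebra, 𝔇.𝔅)`; converse of the accepted `PstWeilDeligneData.isDeRhamFramed_of_blockDiagonal`).
Ref: Fontaine, Astérisque 223 (1994), Exposé III, Prop. 1.5.2; Brinon–Conrad 2009, Thm. 5.2.1.
[cite: FontaineAsterisque223III, Prop. 1.5.2] -/
theorem PstWeilDeligneData.isDeRhamFramed_block_of_blockDiagonal [ValuativeRel F] [TopologicalSpace F]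
    [IsNonarchimedeanLocalField F] (𝔇 : PstWeilDeligneData F ℓ) {d n N : ℕ}
    (e : Fin d × Fin n ≃ Fin N) {T : FramedRep (absoluteGaloisGroup F) (PadicAlgCl ℓ) N}
    {B : Fin d → FramedRep (absoluteGaloisGroup F) (PadicAlgCl ℓ) n}
    (hT : ∀ g, ((T g : GL (Fin N) (PadicAlgCl ℓ)) : Matrix (Fin N) (Fin N) (PadicAlgCl ℓ)) =
      Matrix.reindex e e (Matrix.comp (Fin d) (Fin d) (Fin n) (Fin n) (PadicAlgCl ℓ)
        (Matrix.diagonal fun i =>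
          ((B i g : GL (Fin n) (PadicAlgCl ℓ)) : Matrix (Fin n) (Fin n) (PadicAlgCl ℓ)))))
    (h : 𝔇.IsDeRhamFramed T) (i₀ : Fin d) : 𝔇.IsDeRhamFramed (B i₀) :=
  FramedRep.IsDeRhamWith.block_of_blockDiagonal 𝔇.algebra 𝔇.𝔅 e hT h i₀

end DeRhamBlockDiagonal

/-! ### §3 The embeddings `λ⁻¹ ∘ r ∘ ε : E → L` and the blocks of `(Ind_E^K W)|_{Γ_L}` -/

section Embeddings

variable {K E L : Type*} [Field K] [Field E] [Field L] [Algebra K E] [Algebra K L]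
  [Algebra.IsAlgebraic K E] [Algebra.IsAlgebraic K L]

/-- **The embedding `λ⁻¹ ∘ r ∘ ε : E → L`.**  For `r ∈ Γ_K` such that the conjugate `r ε(E)` of the
copy `ε(E) ⊆ K̄` of `E` (`absEmbedding K E`) lies in the copy `λ(L)` of `L` (`absEmbedding K L`),
there is a ring homomorphism `i : E → L` with `λ ∘ i = r ∘ ε` (the tree's private lemma of
`FontainePstInductionSchemataProofs`, same proof).
[cite: MilneFT2022, Ch. 7 (the absolute Galois group: restriction well defined up to conjugacy)] -/
theorem exists_ringHom_absEmbedding_eq_smul (r : absoluteGaloisGroup K)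
    (hr : ∀ x : E, ∃ y : L, absEmbedding K L y = r • absEmbedding K E x) :
    ∃ i : E →+* L, ∀ x, absEmbedding K L (i x) = r • absEmbedding K E x := by
  choose f hf using hr
  have hinj : Function.Injective (absEmbedding K L) := (absEmbedding K L).toRingHom.injective
  refine ⟨{ toFun := f
            map_one' := hinj ?_
            map_mul' := fun x y => hinj ?_
            map_zero' := hinj ?_
            map_add' := fun x y => hinj ?_ }, hf⟩
  · rw [hf, map_one, smul_one, map_one]
  · rw [hf, map_mul, smul_mul', map_mul, hf, hf]
  · rw [hf, map_zero, smul_zero, map_zero]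
  · rw [hf, map_add, smul_add, map_add, hf, hf]

/-- **The block homomorphism at the coset `r res(Γ_E)` is a restriction map along an embedding
`E → L`, up to conjugacy.**  For `r ∈ Γ_K` with `r ε(E) ⊆ λ(L)` there are a ring homomorphism
`i : E → L` and `t ∈ Γ_E` with `r⁻¹ · res_{L/K}(σ) · r = res_{E/K}(t · res_{L/E,i}(σ) · t⁻¹)` for
every `σ ∈ Γ_L` (`exists_ringHom_absEmbedding_eq_smul` and the accepted
`exists_conj_absGaloisRestrict_eq_of_absEmbedding_eq`).
[cite: MilneFT2022, Ch. 7 (the absolute Galois group: restriction well defined up to conjugacy)] -/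
theorem exists_ringHom_conj_absGaloisRestrict_eq (r : absoluteGaloisGroup K)
    (hr : ∀ x : E, ∃ y : L, absEmbedding K L y = r • absEmbedding K E x) :
    ∃ (i : E →+* L) (t : absoluteGaloisGroup E), ∀ σ : absoluteGaloisGroup L,
      r⁻¹ * absGaloisRestrict K L σ * r =
        absGaloisRestrict K E (t * @absGaloisRestrict E L _ _ i.toAlgebra σ * t⁻¹) := by
  obtain ⟨i, hi⟩ := exists_ringHom_absEmbedding_eq_smul r hr
  letI : Algebra E L := i.toAlgebra
  obtain ⟨t, ht⟩ := exists_conj_absGaloisRestrict_eq_of_absEmbedding_eq (K := K) (E := E) (L := L) r hi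
  exact ⟨i, t, ht⟩

end Embeddings

end Literature.NumberTheory.GaloisRepresentations

/-! ### §4 The downward half over any number field, and the equivalence -/

namespace Literature.NumberTheory.PAdicHodge

open Literature.NumberTheory.GaloisRepresentations

/-- **De Rham-ness descends from `Ind_{Γ_E}^{Γ_K} W` to `W`, over any number field `K`** (Patrikis
2019, Lemma 7.2.1, "`V = Ind W` is de Rham if and only if `W` is", downward half, for THE pinned
Fontaine data; the tree had it over `K = ℚ` only, `isDeRhamFramed_of_isDeRhamFramed_induce_holds`):
for number fields `K ⊆ E` with `[E : K] = d` and a framed `W : Γ_E → GL_n(ℚ̄_ℓ)`, if `Ind_{Γ_E}^{Γ_K} W`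
is de Rham at every `v ∣ ℓ` of `K` then `W` is de Rham at every `w ∣ ℓ` of `E`.  Proof: let
`L = normalClosure K E K̄` (a number field) and `rᵢ` the coset representatives of `induce`; for each
`i` choose `εᵢ : E → L`, `tᵢ ∈ Γ_E` with `rᵢ⁻¹ res_{L/K}(σ) rᵢ = res_{E/K}(tᵢ res_{L/E,εᵢ}(σ) tᵢ⁻¹)`
(`exists_ringHom_conj_absGaloisRestrict_eq`).  Then `(Ind W)|_{Γ_L}` is block diagonal with blocks
`Vᵢ = W(tᵢ) (W|_{Γ_L,εᵢ}) W(tᵢ)⁻¹` (`induce_apply_coe_of_forall_conj_mem`), and it is de Rham at every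
`u ∣ ℓ` of `L` (`isDeRhamFramed_toLocal_restrictField`, Brinon–Conrad Prop. 6.3.8 upwards); so the
block `V₀` is de Rham at every `u ∣ ℓ` (`PstWeilDeligneData.isDeRhamFramed_block_of_blockDiagonal`,
Fontaine Prop. 1.5.2), hence so is `W|_{Γ_L,ε₀}` (`isDeRhamFramed_conj_iff`), and `W` is de Rham at
every `w ∣ ℓ` by descent along `ε₀ : E → L` (`DeRhamRestrictFieldDescent_holds`, Brinon–Conrad
Prop. 6.3.8 downwards).
[cite: Patrikis2019, Lemma 7.2.1 (Ch. 2 §7.2, numbering of arXiv:1207.6724)]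
[cite: BrinonConrad2009, Thm. 5.2.1 and Prop. 6.3.8] [cite: FontaineAsterisque223III, Prop. 1.5.2] -/
theorem isDeRhamFramed_toLocal_of_induce (K E : Type) [Field K] [NumberField K] [Field E]
    [NumberField E] [Algebra K E] (d : ℕ) (hd : Module.finrank K E = d) (ℓ : ℕ) [Fact ℓ.Prime] (n : ℕ)
    (W : FramedGaloisRep E (PadicAlgCl ℓ) n)
    (hInd : ∀ (v : HeightOneSpectrum (𝓞 K)) (hv : ((ℓ : ℕ) : 𝓞 K) ∈ v.asIdeal),
      (fontainePstAdicCompletion v ℓ hv).IsDeRhamFramed ((W.induce K hd).toLocal v))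
    (w : HeightOneSpectrum (𝓞 E)) (hw : ((ℓ : ℕ) : 𝓞 E) ∈ w.asIdeal) :
    (fontainePstAdicCompletion w ℓ hw).IsDeRhamFramed (W.toLocal w) := by
  classical
  -- the Galois closure of `E/K` inside `K̄`
  let Lf : IntermediateField K (AlgebraicClosure K) :=
    IntermediateField.normalClosure K E (AlgebraicClosure K)
  haveI : NumberField Lf := NumberField.of_module_finite K Lf
  -- every conjugate of `ε(E)` lies in `λ(L) = L`
  have hcl : ∀ (r : absoluteGaloisGroup K) (x : E),
      ∃ y : Lf, absEmbedding K Lf y = r • absEmbedding K E x := by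
    intro r x
    have hx : absEmbedding K E x ∈ Lf := (absEmbedding K E).fieldRange_le_normalClosure ⟨x, rfl⟩
    have hrx : r • absEmbedding K E x ∈ Lf := by
      refine (IntermediateField.normal_iff_forall_map_le'.1 (normalClosure.normal K E _)
        (absoluteGaloisGroup.toAlgEquiv K r)) ?_
      exact (IntermediateField.mem_map _).2 ⟨_, hx, rfl⟩
    rw [← AlgHom.fieldRange_of_normal (absEmbedding K Lf)] at hrx
    exact AlgHom.mem_fieldRange.1 hrx
  -- the embeddings `εᵢ : E → L` and the frame changes `tᵢ` at the coset representatives `rᵢ`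
  choose ε t ht using fun i : Fin d =>
    exists_ringHom_conj_absGaloisRestrict_eq (L := Lf) (absGaloisCosetRep K E hd i) (hcl _)
  -- the blocks `Vᵢ = W(tᵢ) (W|_{Γ_L, εᵢ}) W(tᵢ)⁻¹`
  let V : Fin d → FramedGaloisRep Lf (PadicAlgCl ℓ) n := fun i =>
    FramedRep.conj (W (t i)) (W.comp (@absGaloisRestrict E Lf _ _ (ε i).toAlgebra))
  have hV : ∀ (i : Fin d) (σ : absoluteGaloisGroup Lf),
      V i σ = W (t i * @absGaloisRestrict E Lf _ _ (ε i).toAlgebra σ * (t i)⁻¹) := fun i σ => by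
    change FramedRep.conj (W (t i)) (W.comp (@absGaloisRestrict E Lf _ _ (ε i).toAlgebra)) σ = _
    rw [FramedRep.conj_apply, map_mul, map_mul, map_inv]
    rfl
  -- `(Ind W)|_{Γ_L}` is block diagonal with blocks `Vᵢ`, at every place `u` of `L`
  have hshape : ∀ (u : HeightOneSpectrum (𝓞 Lf)) (g : absoluteGaloisGroup (u.adicCompletion Lf)),
      (((((W.induce K hd).restrictField Lf).toLocal u) g : GL (Fin (d * n)) (PadicAlgCl ℓ)) :
          Matrix (Fin (d * n)) (Fin (d * n)) (PadicAlgCl ℓ)) =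
        Matrix.reindex finProdFinEquiv finProdFinEquiv
          (Matrix.comp (Fin d) (Fin d) (Fin n) (Fin n) (PadicAlgCl ℓ)
            (Matrix.diagonal fun i =>
              (((V i).toLocal u g : GL (Fin n) (PadicAlgCl ℓ)) : Matrix (Fin n) (Fin n) (PadicAlgCl ℓ)))) := by
    intro u g
    set σ := absGaloisRestrict Lf (u.adicCompletion Lf) g with hσ
    have hmem : ∀ i : Fin d, (absGaloisCosetRep K E hd i)⁻¹ * absGaloisRestrict K Lf σ *
        absGaloisCosetRep K E hd i ∈ (absGaloisRestrict K E).range := fun i => ⟨_, (ht i σ).symm⟩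
    have hblocks : (fun i : Fin d => dotExtend (absGaloisRestrict K E).toMonoidHom
        (FramedRep.toMatrixHom W)
        ((absGaloisCosetRep K E hd i)⁻¹ * absGaloisRestrict K Lf σ * absGaloisCosetRep K E hd i)) =
        fun i => (((V i).toLocal u g : GL (Fin n) (PadicAlgCl ℓ)) :
          Matrix (Fin n) (Fin n) (PadicAlgCl ℓ)) := by
      funext i
      rw [FramedGaloisRep.dotExtend_eq_of_eq_absGaloisRestrict K W (ht i σ), FramedGaloisRep.toLocal_apply,
        ← hσ, hV]
    rw [FramedGaloisRep.toLocal_apply, ← hσ, FramedGaloisRep.restrictField_apply,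
      FramedGaloisRep.induce_apply_coe_of_forall_conj_mem K hd W _ hmem, hblocks]
  -- descent along `ε₀ : E → L`
  have hdpos : 0 < d := by
    rw [← hd]
    exact Module.finrank_pos
  let i₀ : Fin d := ⟨0, hdpos⟩
  letI : Algebra E Lf := (ε i₀).toAlgebra
  refine DeRhamRestrictFieldDescent_holds E Lf ℓ n W (fun u hu => ?_) w hw
  -- `(Ind W)|_{Γ_L}` is de Rham at `u` (upward half of Brinon–Conrad 6.3.8), hence so is its block `V₀`
  have hT : (fontainePstAdicCompletion u ℓ hu).IsDeRhamFramed
      (((W.induce K hd).restrictField Lf).toLocal u) :=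
    isDeRhamFramed_toLocal_restrictField DeRhamBaseChange_holds (W.induce K hd) hInd u hu
  have hV₀ : (fontainePstAdicCompletion u ℓ hu).IsDeRhamFramed ((V i₀).toLocal u) :=
    (fontainePstAdicCompletion u ℓ hu).isDeRhamFramed_block_of_blockDiagonal finProdFinEquiv
      (hshape u) hT i₀
  -- and `V₀|_{Γ_{L_u}}` is a change of frame of `(W|_{Γ_L})|_{Γ_{L_u}}`
  change (fontainePstAdicCompletion u ℓ hu).IsDeRhamFramed
    ((FramedRep.conj (W (t i₀)) (W.restrictField Lf)).comp (absGaloisRestrict Lf (u.adicCompletion Lf)))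
    at hV₀
  rw [FramedRep.conj_comp, PstWeilDeligneData.isDeRhamFramed_conj_iff] at hV₀
  exact hV₀

/-- **`Ind_{Γ_E}^{Γ_K} W` is de Rham at every place of `K` above `ℓ` iff `W` is de Rham at every place
of `E` above `ℓ`, for THE pinned Fontaine data** (Patrikis 2019, Lemma 7.2.1, "`V` is de Rham if and
only if `W` is", globalised: `isDeRhamFramed_toLocal_of_induce` and the accepted upward half
`IsDeRhamFramedInduceSchema_holds`).
[cite: Patrikis2019, Lemma 7.2.1 (Ch. 2 §7.2, numbering of arXiv:1207.6724)]
[cite: BrinonConrad2009, Thm. 5.2.1 and Prop. 6.3.8] -/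
theorem isDeRhamFramed_induce_iff (K E : Type) [Field K] [NumberField K] [Field E] [NumberField E]
    [Algebra K E] (d : ℕ) (hd : Module.finrank K E = d) (ℓ : ℕ) [Fact ℓ.Prime] (n : ℕ)
    (W : FramedGaloisRep E (PadicAlgCl ℓ) n) :
    (∀ (v : HeightOneSpectrum (𝓞 K)) (hv : ((ℓ : ℕ) : 𝓞 K) ∈ v.asIdeal),
        (fontainePstAdicCompletion v ℓ hv).IsDeRhamFramed ((W.induce K hd).toLocal v)) ↔
      ∀ (w : HeightOneSpectrum (𝓞 E)) (hw : ((ℓ : ℕ) : 𝓞 E) ∈ w.asIdeal),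
        (fontainePstAdicCompletion w ℓ hw).IsDeRhamFramed (W.toLocal w) :=
  ⟨isDeRhamFramed_toLocal_of_induce K E d hd ℓ n W, IsDeRhamFramedInduceSchema_holds K E d hd ℓ n W⟩

end Literature.NumberTheory.PAdicHodge

end
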